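import Mathlib
import Summits.ValiantsHypothesis.ValiantsHypothesis.Theorems.RigidityForcesSymmetryRankRigidMinimalReprLaplaceFiveTilingsDefs

/-!
# Unit tilings of `𝔖₅` by ten Young blocks, I — the classification: every tiling is one of `520` listed ones
# (crux `RankRigidMinimalRepr`, stmt-ValiantsHypothesis-18034; frontier rung `LaplaceOptimalFive`, stmt-24813; first rung of
#  K1 «odd surfacing» of the line «shallow-collision ledger» on 24813, crux idea `twin-span-depth` (ii))

Vocabulary from `…LaplaceFiveTilingsDefs.lean`: Young blocks `B(S, A)` (`|S| = |A| = 2`) of permutations `v : Fin 5 → Fin 5` with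
`v(S) = A`, indexed by `Fin 10 × Fin 10` through `pairOf`; a UNIT TILING is a set of blocks containing every permutation exactly once.

Main results of this file:
* `mem_tilingsI_of_isTilingI` — **every unit tiling is a member of the explicit finite set `tilingsI`**, the union of the SIX
  FAMILIES F1 slot-Laplace `{(s₀, a)}_a` (`10`, split type `(10)`), F2 letter-Laplace `{(s, l)}_s` (`10`, `(1¹⁰)`), F3 (`100`,
  `(7,1,1,1)`), F4 (`100`, `(4,1⁶)`), F5 (`150`, `(3,3,1⁴)`), F6 (`150`, `(4,2,2,2)`) (`memF1 … memF6`; the slot/letter duality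
  `v ↦ v⁻¹` swaps F1/F2, F3/F4, F5/F6);
* `card_tilingsI : tilingsI.card = 520`;
* `wit_spec` / `compatI_disjoint` — two distinct blocks are disjoint iff COMPATIBLE (`compatI`: same split ⇒ different letter
  pairs; splits sharing a slot ⇒ letter pairs equal or disjoint; disjoint splits ⇒ letter pairs meet);
* certificates of the packed tables: `interI_spec`, `img_spec`, `img_perfect`, `pairOf_eq_lo_hi`, `pairOf_pairIdx`.
The converse (every member of `tilingsI` is a tiling), the descriptive reading of the families, the split types, the
sharing-pair corollary and the `Finset (Finset (Fin 5) × Finset (Fin 5))` forms are in `…LaplaceFiveTilingsFamilies.lean`.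

Method: the PERFECT PIVOT SYSTEM `W` (ten permutations meeting each of the `100` blocks exactly once, `img_perfect`) turns
«enumerate all tilings» into a kernel search (`search`, `decide +kernel`) over the split assigned to each pivot, pruned by the
pairwise compatibility of the induced blocks (`4 120` nodes, `520` leaves = the tilings, each found exactly once); the leaves are
matched against the six families listed in pivot order.  No `native_decide`.  Independent check: `520 = 10+10+100+100+150+150` is
also the count of val-idea-19 g3's enumeration quoted in the idea card `twin-span-depth`.

HONEST FRAMING: a finite combinatorial fact (helper toward K1 `odd_surfacing_five` of
`Cruxes/LaplaceOptimalFive/TwinSpanDepthSketch.lean`); `LaplaceOptimalFive` (stmt-24813) stays OPEN; nothing here bears on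
`VP ≠ VNP`, which is NOT proved.
-/

set_option autoImplicit false

-- the mandated summit-side namespace repeats a component by design (single-problem summit)
set_option linter.dupNamespace false

namespace Summit.ValiantsHypothesis.ValiantsHypothesis.Theorems.RigidityForcesSymmetryRankRigidMinimalRepr

namespace LaplaceFiveTilings

open Finset Function

/-! ### §1 Certificates of the tables -/

/-- Every indexed pair has two elements. -/
theorem pairOf_card : ∀ i : Fin 10, (pairOf i).card = 2 := by decide +kernel

/-- `pairOf i = {lo i, hi i}` with `lo i ≠ hi i`. -/
theorem pairOf_eq_lo_hi : ∀ i : Fin 10, pairOf i = {lo i, hi i} ∧ lo i ≠ hi i := by decide +kernel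

/-- `pairOf` is injective. -/
theorem pairOf_injective : Function.Injective pairOf := by
  intro i j; revert i j; decide +kernel

/-- `idxOf` inverts `pairOf` on `2`-subsets. -/
theorem pairOf_idxOf : ∀ S : Finset (Fin 5), S.card = 2 → pairOf (idxOf S) = S := by decide +kernel

/-- `idxOf (pairOf i) = i`. -/
theorem idxOf_pairOf : ∀ i : Fin 10, idxOf (pairOf i) = i := by decide +kernel

/-- `pairIdx x y` indexes `{x, y}` for `x ≠ y`. -/
theorem pairOf_pairIdx : ∀ x y : Fin 5, x ≠ y → pairOf (pairIdx x y) = {x, y} := by decide +kernel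

/-- Certificate of the intersection table. -/
theorem interI_spec : ∀ i j : Fin 10, interI i j = (pairOf i ∩ pairOf j).card := by decide +kernel

/-- Compatibility is symmetric. -/
theorem compatI_symm : ∀ b b' : Fin 10 × Fin 10, compatI b b' = compatI b' b := by decide +kernel

/-- The pivots are permutations. -/
theorem W_injective : ∀ k : Fin 10, Function.Injective (W k) := by decide +kernel

/-- Certificate of the image table: the pivot `W k` maps the split `pairOf s` onto the letter pair `pairOf (img k s)`. -/
theorem img_spec : ∀ k s : Fin 10, (pairOf s).image (W k) = pairOf (img k s) := by decide +kernel

/-- Perfectness of the pivot system: on every split, the ten pivots realise all ten letter pairs. -/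
theorem img_perfect : ∀ s a : Fin 10, ∃ k : Fin 10, img k s = a := by decide +kernel

/-- Hence two different pivots never lie in a common block. -/
theorem img_ne : ∀ j k s : Fin 10, j ≠ k → img j s ≠ img k s := by decide +kernel

/-! ### §2 Compatibility = disjointness -/

set_option maxHeartbeats 4000000 in
/-- **Incompatible distinct blocks meet**: `mkWit` is a permutation lying in both (kernel certificate over all `10⁴` pairs). -/
theorem wit_spec : ∀ s a s' a' : Fin 10, compatI (s, a) (s', a') = false → (s ≠ s' ∨ a ≠ a') →
    Function.Injective (mkWit (pairOf s) (pairOf s') (pairOf a) (pairOf a')) ∧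
    (pairOf s).image (mkWit (pairOf s) (pairOf s') (pairOf a) (pairOf a')) = pairOf a ∧
    (pairOf s').image (mkWit (pairOf s) (pairOf s') (pairOf a) (pairOf a')) = pairOf a' := by
  decide +kernel

/-- Compatible blocks have DIFFERENT intersection sizes on the slot and on the letter side. -/
theorem compatI_inter_ne : ∀ b b' : Fin 10 × Fin 10, compatI b b' = true → interI b.2 b'.2 ≠ interI b.1 b'.1 := by
  decide +kernel

/-- **Compatible blocks are disjoint**: no permutation lies in two compatible blocks — the letter pairs of the two blocks
containing an injective word meet in as many letters as the splits meet in slots. -/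
theorem compatI_disjoint {b b' : Fin 10 × Fin 10} (hc : compatI b b' = true) {v : Fin 5 → Fin 5}
    (hv : Function.Injective v) (h1 : (pairOf b.1).image v = pairOf b.2) (h2 : (pairOf b'.1).image v = pairOf b'.2) :
    False := by
  apply compatI_inter_ne b b' hc
  rw [interI_spec, interI_spec, ← h1, ← h2, ← Finset.image_inter _ _ hv, Finset.card_image_of_injective _ hv]

/-! ### §3 Sizes of the families; the `520` members of `tilingsI` are distinct -/

/-- Family sizes. -/
theorem ALL_lengths : ALL1.length = 10 ∧ ALL2.length = 10 ∧ ALL3.length = 100 ∧ ALL4.length = 100 ∧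
    ALL5.length = 150 ∧ ALL6.length = 150 ∧ ALL.length = 520 := by decide +kernel

/-- The `520` listed tilings are pairwise distinct as SETS of blocks (certificate: their bit codes are distinct). -/
theorem ALL_codes_nodup : ((ALL.map List.toFinset).map fun T => ∑ b ∈ T, 2 ^ (10 * b.1.val + b.2.val)).Nodup := by
  rw [List.map_map]; decide +kernel

/-- **There are exactly `520` unit tilings** (as sets of indexed blocks; that these are all is `isTilingI_iff_mem_tilingsI`). -/
theorem card_tilingsI : tilingsI.card = 520 := by
  rw [tilingsI, List.toFinset_card_of_nodup (ALL_codes_nodup.of_map _), List.length_map, ALL_lengths.2.2.2.2.2.2]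

/-! ### §4 The kernel search and the classification -/

/-- **KERNEL SEARCH** over the splits assigned to the ten pivots: every pairwise compatible assignment is a listed tiling
(`4 120` nodes, `520` leaves — one per tiling, since every block contains exactly one pivot). -/
theorem search :
    ∀ c0 : Fin 10,
    ∀ c1 : Fin 10, ok [blk 0 c0] (blk 1 c1) = true →
    ∀ c2 : Fin 10, ok [blk 0 c0, blk 1 c1] (blk 2 c2) = true →
    ∀ c3 : Fin 10, ok [blk 0 c0, blk 1 c1, blk 2 c2] (blk 3 c3) = true →
    ∀ c4 : Fin 10, ok [blk 0 c0, blk 1 c1, blk 2 c2, blk 3 c3] (blk 4 c4) = true →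
    ∀ c5 : Fin 10, ok [blk 0 c0, blk 1 c1, blk 2 c2, blk 3 c3, blk 4 c4] (blk 5 c5) = true →
    ∀ c6 : Fin 10, ok [blk 0 c0, blk 1 c1, blk 2 c2, blk 3 c3, blk 4 c4, blk 5 c5] (blk 6 c6) = true →
    ∀ c7 : Fin 10, ok [blk 0 c0, blk 1 c1, blk 2 c2, blk 3 c3, blk 4 c4, blk 5 c5, blk 6 c6] (blk 7 c7) = true →
    ∀ c8 : Fin 10, ok [blk 0 c0, blk 1 c1, blk 2 c2, blk 3 c3, blk 4 c4, blk 5 c5, blk 6 c6, blk 7 c7] (blk 8 c8) = true →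
    ∀ c9 : Fin 10,
      ok [blk 0 c0, blk 1 c1, blk 2 c2, blk 3 c3, blk 4 c4, blk 5 c5, blk 6 c6, blk 7 c7, blk 8 c8] (blk 9 c9) = true →
    [blk 0 c0, blk 1 c1, blk 2 c2, blk 3 c3, blk 4 c4, blk 5 c5, blk 6 c6, blk 7 c7, blk 8 c8, blk 9 c9] ∈ ALL := by
  decide +kernel

/-- **CLASSIFICATION**: every unit tiling is one of the `520` listed ones. -/
theorem mem_tilingsI_of_isTilingI {𝒯 : Finset (Fin 10 × Fin 10)}
    (h : ∀ v : Fin 5 → Fin 5, Function.Injective v → ∃! b, b ∈ 𝒯 ∧ (pairOf b.1).image v = pairOf b.2) :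
    𝒯 ∈ tilingsI := by
  classical
  have hex : ∀ k, ∃ b, b ∈ 𝒯 ∧ (pairOf b.1).image (W k) = pairOf b.2 := fun k => (h (W k) (W_injective k)).exists
  choose β hβ hβimg using hex
  have huniq : ∀ v, Function.Injective v → ∀ b b', b ∈ 𝒯 → (pairOf b.1).image v = pairOf b.2 →
      b' ∈ 𝒯 → (pairOf b'.1).image v = pairOf b'.2 → b = b' :=
    fun v hv b b' hb hbv hb' hb'v => (h v hv).unique ⟨hb, hbv⟩ ⟨hb', hb'v⟩
  -- the block of `𝒯` through the pivot `W k` is `blk k (β k).1`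
  have hblk : ∀ k, blk k (β k).1 = β k := by
    intro k
    refine Prod.ext rfl (pairOf_injective ?_)
    show pairOf (img k (β k).1) = pairOf (β k).2
    rw [← img_spec, hβimg]
  -- distinct pivots give compatible blocks
  have hcompat : ∀ j k, j ≠ k → compatI (β j) (β k) = true := by
    intro j k hjk
    by_contra hc
    rw [Bool.not_eq_true] at hc
    have hne : (β j).1 ≠ (β k).1 ∨ (β j).2 ≠ (β k).2 := by
      by_contra hcon
      push Not at hcon
      apply img_ne j k (β j).1 hjk
      have hj := congrArg Prod.snd (hblk j)
      have hk := congrArg Prod.snd (hblk k)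
      simp only [blk] at hj hk
      rw [hj, hcon.1, hcon.2, hk]
    obtain ⟨hvinj, hvj, hvk⟩ := wit_spec (β j).1 (β j).2 (β k).1 (β k).2 hc hne
    have := huniq _ hvinj (β j) (β k) (hβ j) hvj (hβ k) hvk
    exact hne.elim (fun h1 => h1 (congrArg Prod.fst this)) (fun h2 => h2 (congrArg Prod.snd this))
  have hok : ∀ (js : List (Fin 10)) (k : Fin 10), k ∉ js → ok (js.map β) (β k) = true := by
    intro js k hk
    simp only [ok, List.all_map, List.all_eq_true, Function.comp]
    intro j hj
    exact hcompat j k (fun hjk => hk (hjk ▸ hj))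
  have hmem := search (β 0).1 (β 1).1 (by simp only [hblk]; exact hok [0] 1 (by decide))
    (β 2).1 (by simp only [hblk]; exact hok [0, 1] 2 (by decide))
    (β 3).1 (by simp only [hblk]; exact hok [0, 1, 2] 3 (by decide))
    (β 4).1 (by simp only [hblk]; exact hok [0, 1, 2, 3] 4 (by decide))
    (β 5).1 (by simp only [hblk]; exact hok [0, 1, 2, 3, 4] 5 (by decide))
    (β 6).1 (by simp only [hblk]; exact hok [0, 1, 2, 3, 4, 5] 6 (by decide))
    (β 7).1 (by simp only [hblk]; exact hok [0, 1, 2, 3, 4, 5, 6] 7 (by decide))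
    (β 8).1 (by simp only [hblk]; exact hok [0, 1, 2, 3, 4, 5, 6, 7] 8 (by decide))
    (β 9).1 (by simp only [hblk]; exact hok [0, 1, 2, 3, 4, 5, 6, 7, 8] 9 (by decide))
  simp only [hblk] at hmem
  -- `𝒯` is the set of the ten pivot blocks
  have hT : 𝒯 = [β 0, β 1, β 2, β 3, β 4, β 5, β 6, β 7, β 8, β 9].toFinset := by
    ext b
    simp only [List.mem_toFinset, List.mem_cons, List.not_mem_nil, or_false]
    constructor
    · intro hb
      obtain ⟨k, hk⟩ := img_perfect b.1 b.2
      have hbk : b = β k := huniq (W k) (W_injective k) b (β k) hb (by rw [img_spec, hk]) (hβ k) (hβimg k)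
      subst hbk
      fin_cases k <;> simp
    · rintro (rfl | rfl | rfl | rfl | rfl | rfl | rfl | rfl | rfl | rfl) <;> exact hβ _
  rw [tilingsI, List.mem_toFinset, List.mem_map]
  exact ⟨_, hmem, hT.symm⟩

end LaplaceFiveTilings

end Summit.ValiantsHypothesis.ValiantsHypothesis.Theorems.RigidityForcesSymmetryRankRigidMinimalRepr
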